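import Literature.MathematicalPhysics.KineticTheory.VelocityFlipNoise
import HarnessLib

/-!
# The group generated by the single-site momentum flips

Trunk T-KINETIC (Literature/MathematicalPhysics/KineticTheory), companion of `VelocityFlipNoise.lean`.
The single-site flips `ω ↦ ω^i` (`momentumFlip i`) are commuting linear isometric involutions of
phase space; they generate the group `(ℤ/2)^N` of MULTI-SITE flips
`ω ↦ ω^w = (q, (if j ∈ w then -p_j else p_j)_j)`, `w ⊆ Fin N` — the orbit structure behind the
velocity-flip noise `S f = ∑_i (f ∘ ·^i - f)` (Bernardin–Olla 2011, §2.1), needed whenever `S` is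
treated as a perturbation by a finite group of symmetries (e.g. the hypoellipticity of `L + εS`
through the conjugates `u ∘ ·^w`). To keep the file definition-free the multi-site flip is an
arbitrary family `Φ` satisfying its defining equation
`hΦ : ∀ w x, Φ w x = (x.1, fun j => if j ∈ w then -x.2 j else x.2 j)`:

* `multiFlip_multiFlip` (involution), `multiFlip_empty`, `multiFlip_momentumFlip`
  (`(ω^i)^w = ω^{w ∆ {i}}`), `momentumFlip_multiFlip` (the flips commute),
  `continuous_multiFlip`, `measurePreserving_multiFlip` (Liouville measure),
  `hamiltonian_multiFlip`;
* `exists_multiFlip_equiv` — `ω ↦ ω^w` is (the coercion of) a continuous linear equivalence of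
  phase space which is its own inverse.

## References

* C. Bernardin, S. Olla, *Transport properties of a chain of anharmonic oscillators with random
  flip of velocities*, J. Stat. Phys. 145 (2011), §2.1 (the flips `ω^x`; folklore group structure).
-/

noncomputable section

open MeasureTheory Filter Topology

namespace Literature.MathematicalPhysics.KineticTheory.HeatConduction

variable {N : ℕ} (Φ : Finset (Fin N) → PhaseSpace N → PhaseSpace N)
  (hΦ : ∀ w x, Φ w x = (x.1, fun j => if j ∈ w then -x.2 j else x.2 j))
include hΦ

/-- Positions are untouched by the multi-site flip. [folklore] -/
theorem multiFlip_fst (w : Finset (Fin N)) (x : PhaseSpace N) : (Φ w x).1 = x.1 := by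
  rw [hΦ]

/-- The momenta of the multi-site flip: `(p^w)_j = -p_j` for `j ∈ w`, `p_j` otherwise. [folklore] -/
theorem multiFlip_snd (w : Finset (Fin N)) (x : PhaseSpace N) (j : Fin N) :
    (Φ w x).2 j = if j ∈ w then -x.2 j else x.2 j := by
  rw [hΦ]

/-- `ω ↦ ω^w` is an involution. [folklore] -/
theorem multiFlip_multiFlip (w : Finset (Fin N)) (x : PhaseSpace N) : Φ w (Φ w x) = x := by
  refine Prod.ext (by rw [multiFlip_fst Φ hΦ, multiFlip_fst Φ hΦ]) (funext fun j => ?_)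
  rw [multiFlip_snd Φ hΦ, multiFlip_snd Φ hΦ]
  split_ifs <;> ring

/-- The empty flip is the identity. [folklore] -/
theorem multiFlip_empty (x : PhaseSpace N) : Φ ∅ x = x := by
  rw [hΦ]
  simp

/-- **`(ω^i)^w = ω^{w ∆ {i}}`**: composing with a single-site flip toggles the site. [folklore] -/
theorem multiFlip_momentumFlip (w : Finset (Fin N)) (i : Fin N) (x : PhaseSpace N) :
    Φ w (momentumFlip i x) = Φ (symmDiff w {i}) x := by
  refine Prod.ext (by rw [multiFlip_fst Φ hΦ, multiFlip_fst Φ hΦ, momentumFlip_fst]) (funext fun j => ?_)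
  rw [multiFlip_snd Φ hΦ, multiFlip_snd Φ hΦ]
  simp only [Finset.mem_symmDiff, Finset.mem_singleton]
  by_cases hj : j = i
  · subst hj
    rw [momentumFlip_snd_self]
    by_cases hw : j ∈ w <;> simp [hw]
  · rw [momentumFlip_snd_of_ne hj]
    by_cases hw : j ∈ w <;> simp [hw, hj]

/-- **The flips commute**: `(ω^w)^i = (ω^i)^w`. [folklore] -/
theorem momentumFlip_multiFlip (w : Finset (Fin N)) (i : Fin N) (x : PhaseSpace N) :
    momentumFlip i (Φ w x) = Φ w (momentumFlip i x) := by
  refine Prod.ext (by rw [momentumFlip_fst, multiFlip_fst Φ hΦ, multiFlip_fst Φ hΦ, momentumFlip_fst])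
    (funext fun j => ?_)
  by_cases hj : j = i
  · subst hj
    rw [momentumFlip_snd_self, multiFlip_snd Φ hΦ, multiFlip_snd Φ hΦ, momentumFlip_snd_self]
    split_ifs <;> ring
  · rw [momentumFlip_snd_of_ne hj, multiFlip_snd Φ hΦ, multiFlip_snd Φ hΦ, momentumFlip_snd_of_ne hj]

/-- For `i ∉ w`, `ω^{insert i w} = (ω^w)^i`. [folklore] -/
theorem multiFlip_insert {w : Finset (Fin N)} {i : Fin N} (hi : i ∉ w) (x : PhaseSpace N) :
    Φ (insert i w) x = momentumFlip i (Φ w x) := by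
  rw [momentumFlip_multiFlip Φ hΦ, multiFlip_momentumFlip Φ hΦ]
  congr 1
  ext j
  simp only [Finset.mem_symmDiff, Finset.mem_singleton, Finset.mem_insert]
  by_cases hj : j = i
  · subst hj; simp [hi]
  · simp [hj]

/-- `ω ↦ ω^w` is continuous. [folklore] -/
theorem continuous_multiFlip (w : Finset (Fin N)) : Continuous (Φ w) := by
  have e : Φ w = fun x : PhaseSpace N => ((x.1, fun j => if j ∈ w then -x.2 j else x.2 j) : PhaseSpace N) :=
    funext (hΦ w)
  rw [e]
  refine continuous_fst.prodMk (continuous_pi fun j => ?_)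
  by_cases hj : j ∈ w
  · simp only [hj, if_true]
    exact ((continuous_apply j).comp continuous_snd).neg
  · simp only [hj, if_false]
    exact (continuous_apply j).comp continuous_snd

/-- **`ω ↦ ω^w` preserves Liouville measure** (a composition of single-site flips). [folklore] -/
theorem measurePreserving_multiFlip (w : Finset (Fin N)) :
    MeasurePreserving (Φ w) (volume : Measure (PhaseSpace N)) volume := by
  classical
  induction w using Finset.induction_on with
  | empty =>
    have e : Φ ∅ = id := funext (multiFlip_empty Φ hΦ)
    rw [e]
    exact MeasurePreserving.id _
  | insert i w hi ih =>
    have e : Φ (insert i w) = momentumFlip i ∘ Φ w := funext (multiFlip_insert Φ hΦ hi)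
    rw [e]
    exact (measurePreserving_momentumFlip_volume i).comp ih

/-- The energy is invariant under every multi-site flip. [folklore] -/
theorem OscillatorChain.hamiltonian_multiFlip (P : OscillatorChain) (w : Finset (Fin N)) (x : PhaseSpace N) :
    P.hamiltonian N (Φ w x) = P.hamiltonian N x := by
  classical
  induction w using Finset.induction_on generalizing x with
  | empty => rw [multiFlip_empty Φ hΦ]
  | insert i w hi ih => rw [multiFlip_insert Φ hΦ hi, P.hamiltonian_momentumFlip, ih]

/-- Change of variables under a multi-site flip: `∫ g(ω^w) dω = ∫ g dω`. [folklore] -/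
theorem integral_comp_multiFlip (w : Finset (Fin N)) (g : PhaseSpace N → ℝ) :
    ∫ x, g (Φ w x) = ∫ x, g x := by
  let e : PhaseSpace N ≃ᵐ PhaseSpace N :=
    { toFun := Φ w, invFun := Φ w, left_inv := multiFlip_multiFlip Φ hΦ w,
      right_inv := multiFlip_multiFlip Φ hΦ w,
      measurable_toFun := (continuous_multiFlip Φ hΦ w).measurable,
      measurable_invFun := (continuous_multiFlip Φ hΦ w).measurable }
  have h : MeasurePreserving e volume volume := measurePreserving_multiFlip Φ hΦ w
  exact h.integral_comp' (f := e) g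

/-- **`ω ↦ ω^w` is a continuous linear equivalence of phase space, equal to its own inverse.**
[folklore] -/
theorem exists_multiFlip_equiv (w : Finset (Fin N)) :
    ∃ F : PhaseSpace N ≃L[ℝ] PhaseSpace N, (∀ x, F x = Φ w x) ∧ ∀ x, F.symm x = Φ w x := by
  let Lw : PhaseSpace N →ₗ[ℝ] PhaseSpace N :=
    { toFun := Φ w
      map_add' := fun x y => by
        refine Prod.ext ?_ (funext fun j => ?_)
        · rw [Prod.fst_add, multiFlip_fst Φ hΦ, multiFlip_fst Φ hΦ, multiFlip_fst Φ hΦ, Prod.fst_add]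
        · rw [Prod.snd_add, Pi.add_apply, multiFlip_snd Φ hΦ, multiFlip_snd Φ hΦ, multiFlip_snd Φ hΦ,
            Prod.snd_add, Pi.add_apply]
          split_ifs <;> ring
      map_smul' := fun c x => by
        refine Prod.ext ?_ (funext fun j => ?_)
        · rw [RingHom.id_apply, Prod.smul_fst, multiFlip_fst Φ hΦ, multiFlip_fst Φ hΦ, Prod.smul_fst]
        · rw [RingHom.id_apply, Prod.smul_snd, Pi.smul_apply, multiFlip_snd Φ hΦ, multiFlip_snd Φ hΦ,
            Prod.smul_snd, Pi.smul_apply, smul_eq_mul, smul_eq_mul]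
          split_ifs <;> ring }
  let Ew : PhaseSpace N ≃ₗ[ℝ] PhaseSpace N :=
    { Lw with
      invFun := Φ w
      left_inv := multiFlip_multiFlip Φ hΦ w
      right_inv := multiFlip_multiFlip Φ hΦ w }
  have hc : Continuous (Φ w) := continuous_multiFlip Φ hΦ w
  let Fw : PhaseSpace N ≃L[ℝ] PhaseSpace N :=
    { Ew with continuous_toFun := hc, continuous_invFun := hc }
  exact ⟨Fw, fun _ => rfl, fun _ => rfl⟩

end Literature.MathematicalPhysics.KineticTheory.HeatConduction
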